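import Summits.BirchSwinnertonDyer.BirchSwinnertonDyer.Theorems.ResidualThetaTransportAtTwoResidualSignedLambdaLowerCMAtTwoSigmaBalance
import Summits.BirchSwinnertonDyer.BirchSwinnertonDyer.Theorems.ResidualThetaTransportAtTwoResidualSignedLambdaLowerCMAtTwoStationEMatrixCStep
import Summits.BirchSwinnertonDyer.BirchSwinnertonDyer.Theorems.ResidualThetaTransportAtTwoResidualSignedLambdaLowerCMAtTwoRhoLayerPairingCoeffSmul
import Summits.BirchSwinnertonDyer.BirchSwinnertonDyer.Theorems.ResidualThetaTransportAtTwoDefs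
import HarnessLib

/-!
# Station (E) of the KZ_g interior, input H9: the `𝒪`-action through `Θ` IS A RING HOM `A : 𝒪 →+* M_r(ℤ₂)` with `A (ι c) = c • 1`,
# and LIN-𝒪 for the Coleman coordinates `π.cvec` of the one-pair pins — `𝒸 (C a • x) i = Σ_j C (A a i j) · 𝒸 x j`

Route `ResidualThetaTransportAtTwo` (RTT), crux RSL_g `ResidualSignedLambdaLowerCMAtTwo` (stmt-BirchSwinnertonDyer-22608), line «onepair» v3f,
registered KERNEL stub `stub_kzgTrivialisation` = station (E). Width seat `prover-bsd-wall-tp2-p2x-w2` g22 (`--supports 22608`, closes nothing by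
itself). THEOREMS ONLY (no `def`, no instance, no notation, no named fact, no `sorry`). BSD is NOT proved by any of this; 22608 / 26074 / 24105
stay OPEN / HOLD.

WHAT (the «ring-hom packaging `a ↦ N(a)`» left open by `…SigmaBalance.lean` §3, and its two consumers):
* §1 `exists_thetaMatrixRingHom` — for `W` on the habitat (`GoodSS W 2`, `a₂(W) = 0`), `v ∣ 2`, a `D_v`-equivariant `Θ : A_ρ ≃+ E[2^∞]^r`:
  ONE ring hom `A : 𝒪 →+* M_r(ℤ₂)` such that for every `a ∈ 𝒪` the level matrices of `Θ ∘ (a·) ∘ Θ⁻¹` on `E[2^k]^r` are residues of `A a`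
  (`Θ(a • Θ⁻¹ P)_j = Σ_i N_k i j • P_i`, `N_k ≡ A a (mod 2^k)` — the currency of `SigmaBalance.exists_padicInt_matrix_theta_smul`), and
  `A (ι c) = c • 1` for `c ∈ ℤ₂`. Proof: the `2`-adic matrix of `a` is UNIQUE (`SigmaBalance.matrix_theta_smul_unique_mod` +
  `PadicInt.ext_of_toZModPow`), and `1`, `a * b` (through `b • (a • m)`, `𝒪` commutative), `a + b`, `ι c` (write `c = (c mod 2^k) + 2^k c'`;
  `E[2^k]` is killed by `2^k`) have the displayed level matrices.
* §2 `OnePairPins.exists_thetaMatrixRingHom_pair_smul` — at the pins `π`: Σ_pair `⟨a • y, Q⟩_m = Σ_i Σ_j A a i j · ⟨y, Q_i δ_j⟩_m` in `ℤ₂` for THE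
  pairing `π.pair` (Σ_bal `SigmaBalance.rhoLayerPairingPk_smul_balance` + `pair_smul_eq_sum_of_levelwise`), and
  `OnePairPins.exists_thetaMatrixRingHom_cvec_C_smul` — LIN-𝒪: `π.cvec (C a • x) = fun i ↦ Σ_j C (A a i j) * π.cvec x j`
  (`colTuple_locd₂_C_smul_matrix`), together with `A (ι c) = c • 1` — exactly the `A`/`hAι`/`hO` inputs of `PriceNode.exists_trivialisation` /
  `exists_equivariant_addEquiv` (p714652).

References: [Kato2004Asterisque] §13.8 (pp. 228–229), §14.9 (p. 239); [SerreInventiones1972] §1.11 Prop. 12; [Greenberg1989] §1 p. 98;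
[Kobayashi2003] (8.23) (p. 18); [Lang1990] Ch. 5 §1.
-/

set_option autoImplicit false
-- the Theorems namespace of this sub repeats the summit name by design (D-0017 nested layout)
set_option linter.dupNamespace false

noncomputable section

open scoped Classical

namespace Summit.BirchSwinnertonDyer.BirchSwinnertonDyer.Theorems.ThetaTransport.SigmaBalance

open CategoryTheory Field NumberField IsDedekindDomain _root_.WeierstrassCurve
  Literature.NumberTheory.EllipticCurves Literature.NumberTheory.GaloisRepresentations
  Literature.NumberTheory.EllipticCurves.GreenbergSelmer Literature.NumberTheory.EllipticCurves.CyclotomicLayer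
  Literature.NumberTheory.EllipticCurves.Kobayashi2003 Literature.NumberTheory.EllipticCurves.Kato2004
  Literature.NumberTheory.EllipticCurves.Rank1Residual
  Summit.BirchSwinnertonDyer.BirchSwinnertonDyer.Theorems.ThetaTransport
  Summit.BirchSwinnertonDyer.BirchSwinnertonDyer.Theorems.OnePair

/-! ## §1 The ring hom `A : 𝒪 →+* M_r(ℤ₂)` of the `𝒪`-action transported through `Θ` -/

section RingHom

variable (W : WeierstrassCurve ℚ) [W.IsElliptic] [W.IsGloballyMinimal] {S : Set (PadicAlgCl 2)} {d : ℕ}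
  (ρ : FramedGaloisRep ℚ ↥(padicCoeffIntegers S) d) {r : ℕ}

omit [W.IsElliptic] [W.IsGloballyMinimal] in
/-- `E[2^k]^r ⊂ E[2^∞]^r` is killed by `2^k`. [cite: SilvermanAEC2009, Cor. III.6.4(b)] -/
theorem pow_nsmul_inclusion_geomTorsion_eq_zero (k : ℕ) (P : Fin r → ↥(geomTorsion W ((2 ^ k : ℕ) : ℤ))) :
    2 ^ k • (fun i ↦ AddSubgroup.inclusion (geomTorsion_natCast_pow_le_geomPrimaryTorsion 2 k W) (P i)) = 0 := by
  funext i
  rw [Pi.smul_apply, Pi.zero_apply, ← map_nsmul, ← natCast_zsmul,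
    show ((2 ^ k : ℕ) : ℤ) • P i = 0 from Subtype.ext (zsmul_coe_geomTorsion_pow W k (P i)), map_zero]

omit [W.IsElliptic] [W.IsGloballyMinimal] in
/-- The inclusion `E[2^k] ⊂ E[2^∞]` commutes with `ℕ`-linear combinations. [folklore] -/
theorem inclusion_sum_nsmul (k : ℕ) (N : Fin r → ℕ) (P : Fin r → ↥(geomTorsion W ((2 ^ k : ℕ) : ℤ))) :
    AddSubgroup.inclusion (geomTorsion_natCast_pow_le_geomPrimaryTorsion 2 k W) (∑ i, N i • P i) =
      ∑ i, N i • AddSubgroup.inclusion (geomTorsion_natCast_pow_le_geomPrimaryTorsion 2 k W) (P i) := by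
  rw [map_sum]
  exact Finset.sum_congr rfl fun i _ ↦ map_nsmul _ _ _

omit [W.IsElliptic] [W.IsGloballyMinimal] in
/-- `ι c • m = (c mod 2^k) • m` for `m ∈ A_ρ` killed by `2^k` (`c = (c mod 2^k) + 2^k c'`). [cite: Kato2004Asterisque, §13.8 (p. 228)] -/
theorem padicIntToCoeffIntegers_smul_of_pow_nsmul_eq_zero (k : ℕ) (c : ℤ_[2]) (m : Cofree ρ ↥(padicCoeffField S))
    (hm : 2 ^ k • m = 0) : padicIntToCoeffIntegers S c • m = (PadicInt.toZModPow k c).val • m := by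
  obtain ⟨c', hc⟩ := exists_eq_val_add_pow_mul k c
  conv_lhs => rw [hc]
  rw [map_add, map_mul, map_pow, map_natCast, map_natCast, add_smul, mul_comm, mul_smul, ← Nat.cast_pow, Nat.cast_smul_eq_nsmul,
    Nat.cast_smul_eq_nsmul, hm, smul_zero, add_zero]

/-- **The `𝒪`-action through `Θ` is a ring hom `A : 𝒪 →+* M_r(ℤ₂)` with `A (ι c) = c • 1`.** For `W` on the habitat (`GoodSS W 2`, `a₂(W) = 0`),
`v ∣ 2`, a `D_v`-equivariant transport `Θ : A_ρ ≃+ E[2^∞]^r`: there is ONE ring hom `A` such that every `a ∈ 𝒪` has level matrices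
`N_k ∈ ℕ^{r×r}`, `N_k ≡ A a (mod 2^k)`, with `Θ(a • Θ⁻¹ P)_j = Σ_i N_k i j • P_i` on `E[2^k]^r` (INTEGRAL SCHUR, `exists_padicInt_matrix_theta_smul`);
the `2`-adic matrix of `a` is unique (`matrix_theta_smul_unique_mod`), whence multiplicativity (through `b • (a • m)`, `𝒪` commutative), additivity,
`A 1 = 1` and `A (ι c) = c • 1` (`E[2^k]` is killed by `2^k`). [cite: SerreInventiones1972, §1.11 Prop. 12] [cite: Kato2004Asterisque, §13.8 (pp. 228–229)] -/
theorem exists_thetaMatrixRingHom (hss : GoodSS W 2) (ha2 : W.frobeniusTrace 2 = 0)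
    (v : HeightOneSpectrum (𝓞 ℚ)) (hv : ((2 : ℕ) : 𝓞 ℚ) ∈ v.asIdeal)
    (Θ : Cofree ρ ↥(padicCoeffField S) ≃+ (Fin r → ↥(W.geomPrimaryTorsion 2)))
    (hΘ : ∀ (δ : absoluteGaloisGroup (v.adicCompletion ℚ)) (m : Cofree ρ ↥(padicCoeffField S)) (i : Fin r),
      Θ (resGalOfEmb (closureEmb (K := ℚ) (v.adicCompletion ℚ)) δ • m) i =
        resGalOfEmb (closureEmb (K := ℚ) (v.adicCompletion ℚ)) δ • Θ m i) :
    ∃ A : ↥(padicCoeffIntegers S) →+* Matrix (Fin r) (Fin r) ℤ_[2],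
      (∀ c : ℤ_[2], A (padicIntToCoeffIntegers S c) = c • (1 : Matrix (Fin r) (Fin r) ℤ_[2])) ∧
      ∀ a : ↥(padicCoeffIntegers S), ∃ Nk : ℕ → Fin r → Fin r → ℕ,
        (∀ (k : ℕ) (i j : Fin r), ((Nk k i j : ℕ) : ZMod (2 ^ k)) = PadicInt.toZModPow k (A a i j)) ∧
        ∀ (k : ℕ) (P : Fin r → ↥(geomTorsion W ((2 ^ k : ℕ) : ℤ))) (j : Fin r),
          Θ (a • Θ.symm (fun i ↦ AddSubgroup.inclusion (geomTorsion_natCast_pow_le_geomPrimaryTorsion 2 k W) (P i))) j =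
            ∑ i, Nk k i j • AddSubgroup.inclusion (geomTorsion_natCast_pow_le_geomPrimaryTorsion 2 k W) (P i) := by
  classical
  -- the `2`-adic matrix predicate of an element `a ∈ 𝒪`
  let IsMat : ↥(padicCoeffIntegers S) → Matrix (Fin r) (Fin r) ℤ_[2] → Prop := fun a N ↦
    ∃ Nk : ℕ → Fin r → Fin r → ℕ,
      (∀ (k : ℕ) (i j : Fin r), ((Nk k i j : ℕ) : ZMod (2 ^ k)) = PadicInt.toZModPow k (N i j)) ∧
      ∀ (k : ℕ) (P : Fin r → ↥(geomTorsion W ((2 ^ k : ℕ) : ℤ))) (j : Fin r),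
        Θ (a • Θ.symm (fun i ↦ AddSubgroup.inclusion (geomTorsion_natCast_pow_le_geomPrimaryTorsion 2 k W) (P i))) j =
          ∑ i, Nk k i j • AddSubgroup.inclusion (geomTorsion_natCast_pow_le_geomPrimaryTorsion 2 k W) (P i)
  -- existence (integral Schur, `2`-adically packaged)
  have hex : ∀ a, ∃ N, IsMat a N := fun a ↦ by
    obtain ⟨N, Nk, hNk, hN⟩ := exists_padicInt_matrix_theta_smul W hss ha2 ρ v hv Θ hΘ a
    exact ⟨Matrix.of N, Nk, fun k i j ↦ by rw [Matrix.of_apply]; exact hNk k i j, hN⟩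
  -- uniqueness
  have huniq : ∀ a N N', IsMat a N → IsMat a N' → N = N' := by
    rintro a N N' ⟨Nk, hNk, hN⟩ ⟨Nk', hNk', hN'⟩
    ext i j
    refine PadicInt.ext_of_toZModPow.mp fun k ↦ ?_
    rw [← hNk, ← hNk']
    have hd := matrix_theta_smul_unique_mod W Θ a k (hN k) (hN' k) i j
    rw [← Int.cast_natCast (R := ZMod (2 ^ k)) (Nk k i j), ← Int.cast_natCast (R := ZMod (2 ^ k)) (Nk' k i j)]
    exact ((ZMod.intCast_eq_intCast_iff_dvd_sub _ _ _).2 hd).symm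
  choose Mat hMat using hex
  -- `1`
  have h1 : IsMat 1 1 := by
    refine ⟨fun _ i j ↦ if i = j then 1 else 0, fun k i j ↦ ?_, fun k P j ↦ ?_⟩
    · rw [Matrix.one_apply]
      by_cases h : i = j <;> simp [h]
    · rw [one_smul, AddEquiv.apply_symm_apply]
      simp only [ite_smul, one_smul, zero_smul, Finset.sum_ite_eq', Finset.mem_univ, if_true]
  -- `a * b`
  have hmul : ∀ a b, IsMat (a * b) (Mat a * Mat b) := by
    intro a b
    obtain ⟨Nka, hNka, hNa⟩ := hMat a
    obtain ⟨Nkb, hNkb, hNb⟩ := hMat b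
    refine ⟨fun k i l ↦ ∑ j, Nka k i j * Nkb k j l, fun k i l ↦ ?_, fun k P l ↦ ?_⟩
    · rw [Matrix.mul_apply, Nat.cast_sum, map_sum]
      exact Finset.sum_congr rfl fun j _ ↦ by rw [Nat.cast_mul, map_mul, hNka, hNkb]
    · -- `Θ ((a b) • Θ⁻¹ P) = Θ (b • Θ⁻¹ (Θ (a • Θ⁻¹ P)))`, and `Θ (a • Θ⁻¹ P) = incl ∘ P'`, `P' j = Σ_i N_k(a) i j • P i`
      have hPa : Θ (a • Θ.symm (fun i ↦ AddSubgroup.inclusion (geomTorsion_natCast_pow_le_geomPrimaryTorsion 2 k W) (P i))) =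
          fun j ↦ AddSubgroup.inclusion (geomTorsion_natCast_pow_le_geomPrimaryTorsion 2 k W) (∑ i, Nka k i j • P i) := by
        funext j
        rw [hNa k P j, inclusion_sum_nsmul]
      rw [mul_comm a b, mul_smul, ← Θ.symm_apply_apply (a • Θ.symm _), hPa, hNb k _ l]
      simp_rw [inclusion_sum_nsmul, Finset.smul_sum, smul_smul, Finset.sum_smul]
      rw [Finset.sum_comm]
      exact Finset.sum_congr rfl fun i _ ↦ Finset.sum_congr rfl fun j _ ↦ by rw [mul_comm]
  -- `0`
  have h0 : IsMat 0 0 := by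
    refine ⟨fun _ _ _ ↦ 0, fun k i j ↦ ?_, fun k P j ↦ ?_⟩
    · rw [Matrix.zero_apply, map_zero, Nat.cast_zero]
    · rw [zero_smul, map_zero, Pi.zero_apply]
      simp only [zero_smul, Finset.sum_const_zero]
  -- `a + b`
  have hadd : ∀ a b, IsMat (a + b) (Mat a + Mat b) := by
    intro a b
    obtain ⟨Nka, hNka, hNa⟩ := hMat a
    obtain ⟨Nkb, hNkb, hNb⟩ := hMat b
    refine ⟨fun k i j ↦ Nka k i j + Nkb k i j, fun k i j ↦ ?_, fun k P j ↦ ?_⟩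
    · rw [Matrix.add_apply, Nat.cast_add, map_add, hNka, hNkb]
    · rw [add_smul, map_add, Pi.add_apply, hNa, hNb, ← Finset.sum_add_distrib]
      exact Finset.sum_congr rfl fun i _ ↦ by rw [add_smul]
  -- `ι c`
  have hι : ∀ c : ℤ_[2], IsMat (padicIntToCoeffIntegers S c) (c • (1 : Matrix (Fin r) (Fin r) ℤ_[2])) := by
    intro c
    refine ⟨fun k i j ↦ (PadicInt.toZModPow k c).val * (if i = j then 1 else 0), fun k i j ↦ ?_, fun k P j ↦ ?_⟩
    · rw [Matrix.smul_apply, Matrix.one_apply, smul_eq_mul, map_mul, Nat.cast_mul, ZMod.natCast_zmod_val]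
      by_cases h : i = j <;> simp [h]
    · have hm : 2 ^ k • Θ.symm (fun i ↦ AddSubgroup.inclusion (geomTorsion_natCast_pow_le_geomPrimaryTorsion 2 k W) (P i)) = 0 := by
        rw [← map_nsmul, pow_nsmul_inclusion_geomTorsion_eq_zero, map_zero]
      rw [padicIntToCoeffIntegers_smul_of_pow_nsmul_eq_zero ρ k c _ hm, map_nsmul, AddEquiv.apply_symm_apply, Pi.smul_apply]
      simp only [mul_ite, mul_one, mul_zero, ite_smul, zero_smul, Finset.sum_ite_eq', Finset.mem_univ, if_true]
  -- the ring hom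
  refine ⟨{ toFun := Mat, map_one' := ?_, map_mul' := ?_, map_zero' := ?_, map_add' := ?_ }, fun c ↦ ?_, fun a ↦ hMat a⟩
  · exact huniq _ _ _ (hMat 1) h1
  · intro a b
    exact huniq _ _ _ (hMat _) (hmul a b)
  · exact huniq _ _ _ (hMat 0) h0
  · intro a b
    exact huniq _ _ _ (hMat _) (hadd a b)
  · exact huniq _ _ _ (hMat _) (hι c)

end RingHom

/-! ## §2 At the one-pair pins: Σ_pair in `ℤ₂` for `π.pair` and LIN-𝒪 for `π.cvec` through the ring hom `A` -/

section OnePair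

variable {S : Set (PadicAlgCl 2)} (W : WeierstrassCurve ℚ) [W.IsElliptic] [W.IsGloballyMinimal] {κ : ZpExtension ℚ 2}
  {γ : absoluteGaloisGroup ℚ} {S₀ : Finset (HeightOneSpectrum (𝓞 ℚ))} {n : ℕ} {ρ : FramedGaloisRep ℚ ↥(padicCoeffIntegers S) 2}
  {Θ : ∀ v : HeightOneSpectrum (𝓞 ℚ), ((2 : ℕ) : 𝓞 ℚ) ∈ v.asIdeal → (Cofree ρ ↥(padicCoeffField S) ≃+ (Fin n → ↥(W.geomPrimaryTorsion 2)))}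
  {hΘ : ∀ v hv (δ : absoluteGaloisGroup (v.adicCompletion ℚ)) m i,
    Θ v hv (resGalOfEmb (closureEmb (K := ℚ) (v.adicCompletion ℚ)) δ • m) i = resGalOfEmb (closureEmb (K := ℚ) (v.adicCompletion ℚ)) δ • Θ v hv m i}
  {I : Kato2004.IwasawaH1DataCoeff (FramedGaloisRep.toGaloisRep ρ) 2 κ γ}
  {Sg : AddSubgroup (subgroupH1 κ.kerSubgroup (Cofree ρ ↥(padicCoeffField S)))} [Module ↥(padicCoeffIntegers S) ↥Sg]
  (π : OnePairPins S W κ γ S₀ n ρ Θ hΘ I Sg)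

/-- **Σ_pair for THE pairing `π.pair` through the ring hom `A`** (habitat `GoodSS W 2`, `a₂ = 0`): one ring hom `A : 𝒪 →+* M_n(ℤ₂)` with
`A (ι c) = c • 1` and `⟨a • y, Q⟩_m = Σ_i Σ_j A a i j · ⟨y, Q_i δ_j⟩_m` in `ℤ₂` for ALL `a ∈ 𝒪`, layers `m`, classes `y ∈ H¹(Γ_m, T_ρ)` and tuples
`Q ∈ E(ℚ_{m,v})ⁿ` (Σ_bal `rhoLayerPairingPk_smul_balance` with `hc := π.ePk_cofreeTorsionScalar_comm`, the level matrices of §1, `π.hpair`, and the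
`2`-adic packaging `pair_smul_eq_sum_of_levelwise`). [cite: Kato2004Asterisque, §13.8 (pp. 228–229)] [cite: Kobayashi2003, (8.23) (p. 18)] -/
theorem _root_.Summit.BirchSwinnertonDyer.BirchSwinnertonDyer.Theorems.OnePair.OnePairPins.exists_thetaMatrixRingHom_pair_smul
    (hss : GoodSS W 2) (ha2 : W.frobeniusTrace 2 = 0) :
    ∃ A : ↥(padicCoeffIntegers S) →+* Matrix (Fin n) (Fin n) ℤ_[2],
      (∀ c : ℤ_[2], A (padicIntToCoeffIntegers S c) = c • (1 : Matrix (Fin n) (Fin n) ℤ_[2])) ∧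
      ∀ (a : ↥(padicCoeffIntegers S)) (m : ℕ) (y : H1 (FramedGaloisRep.toGaloisRep ρ) (κ.layerSubgroup m))
        (Q : Fin n → ↥(localLayerPointsOfEmb κ (closureEmb (K := ℚ) (π.v.adicCompletion ℚ)) W m)),
        π.pair m (a • y) Q = ∑ i, ∑ j, A a i j * π.pair m y (Pi.single j (Q i)) := by
  obtain ⟨A, hAι, hA⟩ := exists_thetaMatrixRingHom W ρ hss ha2 π.v π.hv (Θ π.v π.hv) (hΘ π.v π.hv)
  refine ⟨A, hAι, fun a m y Q ↦ ?_⟩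
  obtain ⟨Nk, hNk, hN⟩ := hA a
  exact pair_smul_eq_sum_of_levelwise W π.v (pair := π.pair) (a := a) (N := A a)
    (fun m k ↦ rhoLayerPairingPk S ρ W π.ePk π.hμPk π.hadd₁Pk π.hadd₂Pk π.hgalPk (Θ π.v π.hv) κ π.v (hΘ π.v π.hv) m k)
    (fun m k x Q ↦ π.hpair m k x Q) Nk hNk
    (fun m k y Q ↦ rhoLayerPairingPk_smul_balance S ρ W π.ePk π.hμPk π.hadd₁Pk π.hadd₂Pk π.hgalPk (Θ π.v π.hv) κ π.v (hΘ π.v π.hv) a k (Nk k)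
      (fun s t ↦ π.ePk_cofreeTorsionScalar_comm k a s t) (hN k) m y Q) m y Q

/-- **LIN-𝒪 for the Coleman coordinates `𝒸 = π.cvec` through the ring hom `A`**: one ring hom `A : 𝒪 →+* M_n(ℤ₂)` with `A (ι c) = c • 1` and
`π.cvec (C a • x) = fun i ↦ Σ_j C (A a i j) · π.cvec x j` for ALL `a ∈ 𝒪`, `x ∈ 𝐇¹_Γ(T_ρ)` (Σ_pair above, `IwasawaH1DataCoeff.proj_C_smul` and `π.hlocd₂`
through `colTuple_locd₂_C_smul_matrix`, `π.col` being `ℤ₂`-linear) — the `A`/`hAι`/`hO` inputs of `PriceNode.exists_trivialisation` at the pins.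
[cite: Kato2004Asterisque, §12.2 (p. 220), §13.8 (pp. 228–229)] [cite: Kobayashi2003, Thm. 6.2 (p. 18)] -/
theorem _root_.Summit.BirchSwinnertonDyer.BirchSwinnertonDyer.Theorems.OnePair.OnePairPins.exists_thetaMatrixRingHom_cvec_C_smul
    (hss : GoodSS W 2) (ha2 : W.frobeniusTrace 2 = 0) :
    ∃ A : ↥(padicCoeffIntegers S) →+* Matrix (Fin n) (Fin n) ℤ_[2],
      (∀ c : ℤ_[2], A (padicIntToCoeffIntegers S c) = c • (1 : Matrix (Fin n) (Fin n) ℤ_[2])) ∧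
      ∀ (a : ↥(padicCoeffIntegers S)) (x : I.H),
        π.cvec ((PowerSeries.C a : IwasawaAlgebraO S) • x) = fun i ↦ ∑ j, (PowerSeries.C (A a i j) : PowerSeries ℤ_[2]) * π.cvec x j := by
  obtain ⟨A, hAι, hPA⟩ := π.exists_thetaMatrixRingHom_pair_smul W hss ha2
  refine ⟨A, hAι, fun a x ↦ ?_⟩
  have h := colTuple_locd₂_C_smul_matrix I W π.v (pair := π.pair) (locd₂ := π.locd₂) (a := a) (N := A a) (hPA a) π.hlocd₂ π.col x
  funext i
  have hi := congr_fun h i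
  rw [π.cvec_apply, hi]
  exact Finset.sum_congr rfl fun j _ ↦ by rw [PowerSeries.smul_eq_C_mul, π.cvec_apply]

end OnePair

end Summit.BirchSwinnertonDyer.BirchSwinnertonDyer.Theorems.ThetaTransport.SigmaBalance

end
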